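import Summits.CriticalPhenomena.Ising3DConformalLimit.Theses.FKParityRobustness
import Literature.Probability.LatticeModels.UrsellFourCurrents

/-!
# Sketch — crux `IndependentStrandsJoin` (stmt-CriticalPhenomena-14625), crux-ideate round 1, ideator 2

First lemmas of the two idea cards `tetrahedral-sandwich` (Card A) and `fat-shadow-response`
(Card B). Definitions / `Prop`s only (no `sorry`); every constant is an existing declaration of
`Literature.Probability.LatticeModels` (LoopO1.lean, IsingModel.lean, Correlations.lean,
RandomCurrents.lean, UrsellFourCurrents.lean) or of the route file.

Notation (finite graph `G`, `t = tanh β`): `Z^B = loopO1PartitionFunction G t B = Σ_{∂F = B} t^{|F|}`,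
`⟨σ_B⟩ = Z^B/Z⁰` (free Ising, HT expansion), `K_x(F)` = the component of the source `x` in the
`T`-join `F`, `V(K)` its vertex set.
-/

noncomputable section

open Finset MeasureTheory
open Literature.Probability.LatticeModels
open scoped Classical BigOperators

namespace Summit.CriticalPhenomena.Ising3DConformalLimit.Cruxes.IndependentStrandsJoin.SketchIdeator2

variable {V : Type*} [Fintype V] [DecidableEq V]

/-! ## Finite-graph sums -/

/-- `JointSum(G,t,a) = Σ_{F₁ ∈ 𝒯(a₀a₁)} Σ_{F₂ ∈ 𝒯(a₂a₃)} t^{|F₁|+|F₂|} 1[a₀ ↔ a₂ in F₁ ∪ F₂]` — the inner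
double sum of the crux `IndependentStrandsJoin` (verbatim shape). -/
def jointSum (G : SimpleGraph V) [DecidableRel G.Adj] (t : ℝ) (a : Fin 4 → V) : ℝ :=
  ∑ F₁ ∈ tJoins G Set.univ {a 0, a 1}, ∑ F₂ ∈ tJoins G Set.univ {a 2, a 3},
    if (SimpleGraph.fromEdgeSet ((↑F₁ : Set (Sym2 V)) ∪ ↑F₂)).Reachable (a 0) (a 2)
    then t ^ (F₁.card + F₂.card) else 0

/-- `MeetSum(G,t,a)`: same double sum with the SMALLER event "the source clusters share a vertex",
`V(K_{a₀}(F₁)) ∩ V(K_{a₂}(F₂)) ≠ ∅` (so `MeetSum ≤ JointSum` termwise). -/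
def meetSum (G : SimpleGraph V) [DecidableRel G.Adj] (t : ℝ) (a : Fin 4 → V) : ℝ :=
  ∑ F₁ ∈ tJoins G Set.univ {a 0, a 1}, ∑ F₂ ∈ tJoins G Set.univ {a 2, a 3},
    if ∃ v : V, (SimpleGraph.fromEdgeSet (↑F₁ : Set (Sym2 V))).Reachable (a 0) v ∧
               (SimpleGraph.fromEdgeSet (↑F₂ : Set (Sym2 V))).Reachable (a 2) v
    then t ^ (F₁.card + F₂.card) else 0

/-- `Z^A_{Sep01}(G,t,a) = Σ over four-source T-joins D ∈ 𝒯(A) whose a₀-component contains neither a₂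
nor a₃ (the `01|23`-separated pairing) of `t^{|D|}`. -/
def sepSum (G : SimpleGraph V) [DecidableRel G.Adj] (t : ℝ) (a : Fin 4 → V) : ℝ :=
  ∑ D ∈ (tJoins G Set.univ (univ.image a)).filter (fun D : Finset (Sym2 V) =>
      ¬ (SimpleGraph.fromEdgeSet (↑D : Set (Sym2 V))).Reachable (a 0) (a 2) ∧
      ¬ (SimpleGraph.fromEdgeSet (↑D : Set (Sym2 V))).Reachable (a 0) (a 3)),
    t ^ D.card

/-- The PAIRING SYMMETRY of the source quadruple: two automorphisms of `G` fixing `a₀` and realising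
the transpositions `(a₁ a₂)` and `(a₁ a₃)` (for the box `Λ_N ⊂ ℤ³` and `a = l·tetra`: the reflections
`y ↔ z` and `x ↔ z`). -/
def HasPairingSymmetry (G : SimpleGraph V) (a : Fin 4 → V) : Prop :=
  (∃ φ : G ≃g G, φ (a 0) = a 0 ∧ φ (a 1) = a 2 ∧ φ (a 2) = a 1 ∧ φ (a 3) = a 3) ∧
  (∃ ψ : G ≃g G, ψ (a 0) = a 0 ∧ ψ (a 1) = a 3 ∧ ψ (a 3) = a 1 ∧ ψ (a 2) = a 2)

/-! ## Card A — `tetrahedral-sandwich` -/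

/-- **(A0) Separation bound** (any finite graph, no symmetry; provable now from `DepletionBound`
(item 14628) + the cluster bijection `(k, F'') ↦ k ∪ F''` onto `Sep₀₁`):
`Z^{01} Z^{23} − MeetSum ≤ Z^A_{Sep01} · Z⁰`, i.e. `P⊗[V(K₁) ∩ V(K₂) = ∅] ≤ ⟨σ_A⟩_{Sep01}/(⟨σ₀σ₁⟩⟨σ₂σ₃⟩)`.
Checked exactly on Q3 and on 36 random graphs (compute/sandwich_check.py). -/
def SeparationBound : Prop :=
  ∀ (V : Type) [Fintype V] [DecidableEq V] (G : SimpleGraph V) [DecidableRel G.Adj] (β : ℝ), 0 ≤ β →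
    ∀ a : Fin 4 → V, Function.Injective a →
      (let t : ℝ := Real.tanh β
       loopO1PartitionFunction G t {a 0, a 1} * loopO1PartitionFunction G t {a 2, a 3} - meetSum G t a
         ≤ sepSum G t a * loopO1PartitionFunction G t ∅)

/-- **(A1) MeetingFromU4 — the upper sandwich** (FIRST LEMMA of Card A; provable now): on a finite
graph with the pairing symmetry, `−U₄(a)·(Z⁰)² ≤ 3·MeetSum(a)`. Proof: (A0), `3·Z^A_{Sep01} = Z^A − Z^A_J ≤ Z^A`
(symmetry), `Z^A/Z⁰ = ⟨σ_A⟩ = 3⟨σ₀σ₁⟩⟨σ₂σ₃⟩ + U₄` (Lebowitz + symmetry), `⟨σ_B⟩ = Z^B/Z⁰`.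
With `StrandsJoinBound` (item 14647: `U₄·(Z⁰)² ≤ −2·JointSum`) this gives the sandwich
`2·JointSum ≤ |U₄|(Z⁰)² ≤ 3·MeetSum ≤ 3·JointSum`. -/
def MeetingFromU4 : Prop :=
  ∀ (V : Type) [Fintype V] [DecidableEq V] (G : SimpleGraph V) [DecidableRel G.Adj] (β : ℝ), 0 ≤ β →
    ∀ a : Fin 4 → V, Function.Injective a → HasPairingSymmetry G a →
      -(connectedFour (isingMeasure G univ β 0 .free) spinAt a)
          * (loopO1PartitionFunction G (Real.tanh β) ∅) ^ 2
        ≤ 3 * meetSum G (Real.tanh β) a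

/-- **(A2) The transfer target `C⁺ = TetraU4Lattice`**: lattice `U₄`-hyperscaling at the tetrahedron in
large free boxes, `U₄^{Λ_N}(l·tetra) ≤ −c·⟨σ_{a₀}σ_{a₁}⟩_{Λ_N}⟨σ_{a₂}σ_{a₃}⟩_{Λ_N}` — the finite-box form
of clause (iii) restricted to regular tetrahedra (same frame as the crux). -/
def TetraU4Lattice : Prop :=
  let tetra : Fin 4 → Site 3 := ![![-1, -1, -1], ![1, 1, -1], ![1, -1, 1], ![-1, 1, 1]]
  ∃ c : ℝ, 0 < c ∧ ∀ l : ℕ, 1 ≤ l → ∃ N₀ : ℕ, ∀ N : ℕ, N₀ ≤ N → ∀ a : Fin 4 → ↥(box 3 N),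
    (∀ i, ((a i : Site 3)) = (l : ℤ) • tetra i) →
    (let G := (zdGraph 3).comap (Subtype.val : ↥(box 3 N) → Site 3)
     let β : ℝ := criticalBeta 3
     connectedFour (isingMeasure G Finset.univ β 0 .free) spinAt a
       ≤ -(c * isingCorr G Finset.univ β 0 .free {a 0, a 1} * isingCorr G Finset.univ β 0 .free {a 2, a 3}))

/-- **(A3) Transfer, hard direction made easy**: `MeetingFromU4 → TetraU4Lattice → IndependentStrandsJoin`
(constant `c/3`; uses `⟨σ_B⟩^free = Z^B/Z⁰`, `isingCorr_free_eq_hteSum_div`, and `MeetSum ≤ JointSum`). -/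
def TetraU4GivesJoin : Prop :=
  MeetingFromU4 → TetraU4Lattice →
    Summit.CriticalPhenomena.Ising3DConformalLimit.Theses.FKParityRobustness.IndependentStrandsJoin

/-- **(A4) Converse** (the route's own direction): `StrandsJoinBound → IndependentStrandsJoin → TetraU4Lattice`
(constant `2c`). Together with (A3): the crux and lattice (iii)|tetra are ONE statement. -/
def JoinGivesTetraU4 : Prop :=
  Summit.CriticalPhenomena.Ising3DConformalLimit.Theses.FKParityRobustness.StrandsJoinBound →
    Summit.CriticalPhenomena.Ising3DConformalLimit.Theses.FKParityRobustness.IndependentStrandsJoin →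
      TetraU4Lattice

/-- **(A5) The rank-3 crux is also in the class**: `TetraU4Lattice → StrandShadow` (HT-side pairing
deletion `Σ_F t^{|F|}⟨σ₂σ₃⟩_{Λ∖V(K_{a₀}(F))} = Z^A_{Sep01} = Z^A(1 − ℓ^A[J])/3 ≤ (1 − |U₄|/(3G²))·Z^{01}⟨σ₂σ₃⟩`,
up to the junk terms of `isingCorr` for the clusters with `{a₂,a₃} ⊆ V(K)`, which weigh `O(G²) = o(G)`
by the double-current tree bound). So `StrandShadow ⇔ IndependentStrandsJoin ⇔ TetraU4Lattice`. -/
def TetraU4GivesShadow : Prop :=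
  TetraU4Lattice → Summit.CriticalPhenomena.Ising3DConformalLimit.Theses.FKParityRobustness.StrandShadow

/-! ## Card B — `fat-shadow-response` -/

/-- The cluster of `x` in the traced double current `n₁ + n₂`. -/
def dcCluster (G : SimpleGraph V) [DecidableRel G.Adj] (p : Current G × Current G) (x : V) : Finset V :=
  univ.filter fun v => (Literature.Probability.Percolation.openGraph (p.1 + p.2).traced).Reachable x v

/-- **(B1) Double-current shadow identity** (Aizenman–Duminil-Copin 2021, Lemma 8.1 / proof of
Cor. 8.2, finite volume, free b.c.; FIRST LEMMA of Card B, provable now from switching):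
`E^{(a₂a₃,∅)}[ 1[a₀,a₁ ∉ 𝒞(a₂)] · ⟨σ_{a₀}σ_{a₁}⟩_{G∖𝒞(a₂)} ] = ⟨σ_{a₀}σ_{a₁}⟩_G · P^{(a₀a₁,a₂a₃)}[a₀ ↮ a₂]`,
i.e. Aizenman's non-intersection probability `1 − |U₄|/(2⟨σ₀σ₁⟩⟨σ₂σ₃⟩)` is the expected SHADOW RATIO of the
fat double-current cluster `𝒞(a₂)` (dimension `2 − η`, exact one-point function by switching). -/
def DoubleCurrentShadowIdentity : Prop :=
  ∀ (V : Type) [Fintype V] [DecidableEq V] (G : SimpleGraph V) [DecidableRel G.Adj] (β : ℝ), 0 ≤ β →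
    ∀ a : Fin 4 → V, Function.Injective a →
      (∫ p, (if a 0 ∉ dcCluster G p (a 2) ∧ a 1 ∉ dcCluster G p (a 2)
               then isingCorr G (univ \ dcCluster G p (a 2)) β 0 .free {a 0, a 1} else 0)
          ∂(doubleCurrentMeasure G β {a 2, a 3} ∅))
        = isingCorr G univ β 0 .free {a 0, a 1}
            * (1 - (doubleCurrentMeasure G β {a 0, a 1} {a 2, a 3}).real (tracedConn G (a 0) (a 2)))

/-- **(B2) DoubleCurrentShadow — the sharp rung** (⇔ TetraU4Lattice by (B1) + `ursellFour_eq_doubleCurrent`,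
⇔ the crux by Card A): averaged over the `(a₂a₃,∅)` double current in the free box, deleting the couplings at
its `a₂`-cluster cuts the critical two-point function across the OPPOSITE edge of the tetrahedron by a
uniform factor `1 − c`. It is IMPLIED by the route's `StrandShadow` (thin obstacle `V(K)`, `K ⊆ 𝒞` under
the natural coupling, Griffiths II), hence the weakest — and exact — member of the shadow family. -/
def DoubleCurrentShadow : Prop :=
  let tetra : Fin 4 → Site 3 := ![![-1, -1, -1], ![1, 1, -1], ![1, -1, 1], ![-1, 1, 1]]
  ∃ c : ℝ, 0 < c ∧ ∀ l : ℕ, 1 ≤ l → ∃ N₀ : ℕ, ∀ N : ℕ, N₀ ≤ N → ∀ a : Fin 4 → ↥(box 3 N),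
    (∀ i, ((a i : Site 3)) = (l : ℤ) • tetra i) →
    (let G := (zdGraph 3).comap (Subtype.val : ↥(box 3 N) → Site 3)
     let β : ℝ := criticalBeta 3
     (∫ p, (if a 0 ∉ dcCluster G p (a 2) ∧ a 1 ∉ dcCluster G p (a 2)
              then isingCorr G (Finset.univ \ dcCluster G p (a 2)) β 0 .free {a 0, a 1} else 0)
         ∂(doubleCurrentMeasure G β {a 2, a 3} ∅))
       ≤ (1 - c) * isingCorr G Finset.univ β 0 .free {a 0, a 1})

/-- The single-SITE deletion deficit `δ_u(x,y) = 1 − ⟨σ_xσ_y⟩_{G∖{u}}/⟨σ_xσ_y⟩_G ∈ [0,1]`, written in product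
form `⟨σ_xσ_y⟩_G − ⟨σ_xσ_y⟩_{G∖{u}}` (couplings at `u` switched off = `isingCorr G (univ.erase u)`). -/
def siteDeficit (G : SimpleGraph V) [DecidableRel G.Adj] (β : ℝ) (u x y : V) : ℝ :=
  isingCorr G univ β 0 .free {x, y} - isingCorr G (univ.erase u) β 0 .free {x, y}

/-- **(B3) ResponseFloor — the d = 3 input in first-moment form** (the only place a 3D exponent enters;
"the energy operator is relevant on the double-current cluster", `Δ_ε < 2 − η` ⇔ `β_mag < 1/2` via
hyperscaling): the `𝒞(a₂)`-averaged sum of site deficits of `⟨σ_{a₀}σ_{a₁}⟩` is bounded below, where the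
one-point function of `𝒞(a₂)` is written through its EXACT switching value
`P^{(a₂a₃,∅)}[u ∈ 𝒞(a₂)] = ⟨σ_{a₂}σ_u⟩⟨σ_uσ_{a₃}⟩/⟨σ_{a₂}σ_{a₃}⟩` — a pure correlation-function statement:
`Σ_u ⟨σ_{a₂}σ_u⟩⟨σ_uσ_{a₃}⟩·(⟨σ_{a₀}σ_{a₁}⟩ − ⟨σ_{a₀}σ_{a₁}⟩_{Λ∖u}) ≥ c·⟨σ_{a₂}σ_{a₃}⟩⟨σ_{a₀}σ_{a₁}⟩`
(predicted to DIVERGE like `l^{(2−η)−Δ_ε} = l^{0.55}`; asked only `≥ c`). -/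
def ResponseFloor : Prop :=
  let tetra : Fin 4 → Site 3 := ![![-1, -1, -1], ![1, 1, -1], ![1, -1, 1], ![-1, 1, 1]]
  ∃ c : ℝ, 0 < c ∧ ∀ l : ℕ, 1 ≤ l → ∃ N₀ : ℕ, ∀ N : ℕ, N₀ ≤ N → ∀ a : Fin 4 → ↥(box 3 N),
    (∀ i, ((a i : Site 3)) = (l : ℤ) • tetra i) →
    (let G := (zdGraph 3).comap (Subtype.val : ↥(box 3 N) → Site 3)
     let β : ℝ := criticalBeta 3
     c * isingCorr G Finset.univ β 0 .free {a 2, a 3} * isingCorr G Finset.univ β 0 .free {a 0, a 1}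
       ≤ ∑ u : ↥(box 3 N), isingCorr G Finset.univ β 0 .free {a 2, u} * isingCorr G Finset.univ β 0 .free {u, a 3}
           * siteDeficit G β u (a 0) (a 1))

/-- **(B4) Thermal floor for the thin strand** (provable now; site-wise `DepletionBound` with `S = {u}`):
the one-point density of the loop source cluster dominates the site deficit,
`Σ_{F ∈ 𝒯(xy): u ∈ V(K_x(F))} t^{|F|} · ⟨σ_xσ_y⟩_G ≥ Z^{xy} · (⟨σ_xσ_y⟩_G − ⟨σ_xσ_y⟩_{G∖{u}})`.
Summed against the crux's product structure it gives `E|V(K₁) ∩ V(K₂)| ≥ Σ_u δ_u(a₀,a₁)δ_u(a₂,a₃)/…`,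
whose divergence `l^{3−2Δ_ε} = l^{α/ν}` is the (local) divergence of the specific heat. -/
def SiteDepletionFloor : Prop :=
  ∀ (V : Type) [Fintype V] [DecidableEq V] (G : SimpleGraph V) [DecidableRel G.Adj] (β : ℝ), 0 ≤ β →
    ∀ x y u : V, u ≠ x → u ≠ y →
      loopO1PartitionFunction G (Real.tanh β) {x, y} * siteDeficit G β u x y
        ≤ (∑ F ∈ (tJoins G Set.univ {x, y}).filter
            (fun F : Finset (Sym2 V) => (SimpleGraph.fromEdgeSet (↑F : Set (Sym2 V))).Reachable x u),
              Real.tanh β ^ F.card)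
          * isingCorr G univ β 0 .free {x, y}

/-- Sanity links to the crux BY NAME. -/
example : Prop := Summit.CriticalPhenomena.Ising3DConformalLimit.Theses.FKParityRobustness.IndependentStrandsJoin
example : Prop := TetraU4GivesJoin ∧ JoinGivesTetraU4 ∧ TetraU4GivesShadow

end Summit.CriticalPhenomena.Ising3DConformalLimit.Cruxes.IndependentStrandsJoin.SketchIdeator2

end
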